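import Summits.CriticalPhenomena.PercolationContinuityZ3.Theorems.PercNearOneGluingNoHeavyLowerTailKnQuestion8CoefficientwiseAttachmentStable
import HarnessLib

/-!
# The canonical attached set `A*`: intersections of attached sets are attached

Support file (`--supports stmt-CriticalPhenomena-4575`, closed), prover `prim-lf-2` (gen 35).  No definitions, no named facts, no sorries; standard axioms.
Memo `prim-lf-2/CW-INVOLUTION-gen35.md` §2.1–2.2.

Setting as in …CoefficientwiseAttachmentFlipWeak / …AttachmentStable (root `z`, edge set `E₀`, colouring `s ⊆ E₀`; `W` ATTACHED for `s`: every zone vertex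
`w' ∉ W ∪ {z}` joined to `W` by an `E₀`-edge lies in `C_z(s \\ I(W)) ∩ C_z((E₀ \\ s) \\ I(W))`).  For a 'core' vertex set `C` (in the application: the lobe of
the point `w`) put `A*(C, s) := ⋂₀ {W | C ⊆ W ∧ W attached for s}`.
* `Coefficientwise.attached_sInter` — the intersection of ANY family of attached sets is attached (generalises …AttachmentStable `attached_inter`);
  hence `A*(C,s)` is attached and is the smallest attached superset of `C`.  Its flip-invariance `A*(C, s ∆ I(A*)) = A*(C, s)` then follows from
  …AttachmentStable `attached_flip_iff` (attached subsets of `A*` are the same before and after the flip; memo §2.2), and with the selector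
  `s ↦ A*(lobe of w, s)` the selector form of the residue identity (…AttachmentSelector) is the canonical residue identity of the memo;
* `Coefficientwise.lobe_flip_eq` — the lobes (components of the zone minus the core) are unchanged by an attachment flip (zone and core are), so the
  lobe of `w`, from which `A*` is built, does not move under the `A*`-flip.
[cite: KozmaNitzan2024, Questions 8–9 (§5.5 p. 36) (context: the Question-8 pocket covariance programme)]
-/

namespace Summit.CriticalPhenomena.PercolationContinuityZ3.Theorems

open Finset Literature.Probability.Percolation
open scoped symmDiff

namespace Coefficientwise

variable {ι V : Type*}

open Classical in
/-- **Intersections of attached sets are attached.** [cite: KozmaNitzan2024, §5.5 (context only)] -/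
theorem attached_sInter (ends : ι → Sym2 V) {E₀ s : Finset ι} {z : V} (𝓕 : Set (Set V))
    (h𝓕 : ∀ W ∈ 𝓕, ∀ w ∈ W, ∀ i ∈ E₀, ∀ w', ends i = s(w, w') →
      (w' ∈ openCluster (ends '' (↑s : Set ι)) z ∨ w' ∈ openCluster (ends '' (↑(E₀ \ s) : Set ι)) z) → w' ≠ z → w' ∉ W →
        w' ∈ openCluster (ends '' (↑(s \ E₀.filter (fun i => ∃ w, w ∈ W ∧ w ∈ ends i)) : Set ι)) z ∧
        w' ∈ openCluster (ends '' (↑((E₀ \ s) \ E₀.filter (fun i => ∃ w, w ∈ W ∧ w ∈ ends i)) : Set ι)) z) :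
    ∀ w ∈ ⋂₀ 𝓕, ∀ i ∈ E₀, ∀ w', ends i = s(w, w') →
      (w' ∈ openCluster (ends '' (↑s : Set ι)) z ∨ w' ∈ openCluster (ends '' (↑(E₀ \ s) : Set ι)) z) → w' ≠ z → w' ∉ ⋂₀ 𝓕 →
        w' ∈ openCluster (ends '' (↑(s \ E₀.filter (fun i => ∃ w, w ∈ ⋂₀ 𝓕 ∧ w ∈ ends i)) : Set ι)) z ∧
        w' ∈ openCluster (ends '' (↑((E₀ \ s) \ E₀.filter (fun i => ∃ w, w ∈ ⋂₀ 𝓕 ∧ w ∈ ends i)) : Set ι)) z := by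
  intro w hw i hi w' he hU hne hnW
  have hex : ∃ W₀, W₀ ∈ 𝓕 ∧ w' ∉ W₀ := by
    by_contra hcon
    apply hnW
    rw [Set.mem_sInter]
    intro W hW
    by_contra hw'
    exact hcon ⟨W, hW, hw'⟩
  obtain ⟨W₀, hW₀, hw'W₀⟩ := hex
  have hwW₀ : w ∈ W₀ := Set.mem_sInter.mp hw W₀ hW₀
  have h := h𝓕 W₀ hW₀ w hwW₀ i hi w' he hU hne hw'W₀
  have mono : ∀ t : Finset ι,
      openCluster (ends '' (↑(t \ E₀.filter (fun i => ∃ w, w ∈ W₀ ∧ w ∈ ends i)) : Set ι)) z ⊆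
        openCluster (ends '' (↑(t \ E₀.filter (fun i => ∃ w, w ∈ ⋂₀ 𝓕 ∧ w ∈ ends i)) : Set ι)) z := by
    intro t
    refine openCluster_image_mono ends ?_ z
    intro j hj
    rw [Finset.mem_sdiff] at hj ⊢
    refine ⟨hj.1, fun hj' => hj.2 ?_⟩
    rw [Finset.mem_filter] at hj' ⊢
    obtain ⟨hjE, v, hv, hvj⟩ := hj'
    exact ⟨hjE, v, Set.mem_sInter.mp hv W₀ hW₀, hvj⟩
  exact ⟨mono s h.1, mono (E₀ \ s) h.2⟩

open Classical in
/-- **Lobes are invariant under attachment flips.**  Under the weak attachment hypotheses for `W` (so zone and core are unchanged,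
…AttachmentFlipWeak), the component of any vertex `v` in the graph of the `E₀`-edges whose two ends lie in the zone but outside the core — the 'lobe' of `v` —
is the same before and after the flip `s ↦ s ∆ I(W)`; in particular the lobe of the point `w`, from which `A*` is built, does not move.
[cite: KozmaNitzan2024, §5.5 (context only)] -/
theorem lobe_flip_eq (ends : ι → Sym2 V) {E₀ s : Finset ι} {z : V} (hs : s ⊆ E₀) (W : Set V) (hzW : z ∉ W)
    (hWa : ∀ w ∈ W, ∀ i ∈ E₀, ∀ w', ends i = s(w, w') →
      (w' ∈ openCluster (ends '' (↑s : Set ι)) z ∨ w' ∈ openCluster (ends '' (↑(E₀ \ s) : Set ι)) z) → w' ≠ z → w' ∉ W →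
        w' ∈ openCluster (ends '' (↑(s \ E₀.filter (fun i => ∃ w, w ∈ W ∧ w ∈ ends i)) : Set ι)) z ∧
        w' ∈ openCluster (ends '' (↑((E₀ \ s) \ E₀.filter (fun i => ∃ w, w ∈ W ∧ w ∈ ends i)) : Set ι)) z)
    (v : V) :
    openCluster (ends '' (↑(E₀.filter (fun i => ∀ y ∈ ends i,
        (y ∈ openCluster (ends '' (↑(s ∆ E₀.filter (fun i => ∃ w, w ∈ W ∧ w ∈ ends i)) : Set ι)) z ∨
          y ∈ openCluster (ends '' (↑(E₀ \ (s ∆ E₀.filter (fun i => ∃ w, w ∈ W ∧ w ∈ ends i))) : Set ι)) z) ∧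
        ¬ (y ∈ openCluster (ends '' (↑(s ∆ E₀.filter (fun i => ∃ w, w ∈ W ∧ w ∈ ends i)) : Set ι)) z ∧
          y ∈ openCluster (ends '' (↑(E₀ \ (s ∆ E₀.filter (fun i => ∃ w, w ∈ W ∧ w ∈ ends i))) : Set ι)) z))) : Set ι)) v =
    openCluster (ends '' (↑(E₀.filter (fun i => ∀ y ∈ ends i,
        (y ∈ openCluster (ends '' (↑s : Set ι)) z ∨ y ∈ openCluster (ends '' (↑(E₀ \ s) : Set ι)) z) ∧
        ¬ (y ∈ openCluster (ends '' (↑s : Set ι)) z ∧ y ∈ openCluster (ends '' (↑(E₀ \ s) : Set ι)) z))) : Set ι)) v := by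
  have hU := union_flip_eq_attachment ends hs W hzW hWa
  have hD := inter_flip_eq_attachment ends hs W hzW hWa
  have hUy : ∀ y, (y ∈ openCluster (ends '' (↑(s ∆ E₀.filter (fun i => ∃ w, w ∈ W ∧ w ∈ ends i)) : Set ι)) z ∨
        y ∈ openCluster (ends '' (↑(E₀ \ (s ∆ E₀.filter (fun i => ∃ w, w ∈ W ∧ w ∈ ends i))) : Set ι)) z) ↔
      (y ∈ openCluster (ends '' (↑s : Set ι)) z ∨ y ∈ openCluster (ends '' (↑(E₀ \ s) : Set ι)) z) := by
    intro y
    have h := congrArg (fun S : Set V => y ∈ S) hU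
    simpa only [Set.mem_union, eq_iff_iff] using h
  have hDy : ∀ y, (y ∈ openCluster (ends '' (↑(s ∆ E₀.filter (fun i => ∃ w, w ∈ W ∧ w ∈ ends i)) : Set ι)) z ∧
        y ∈ openCluster (ends '' (↑(E₀ \ (s ∆ E₀.filter (fun i => ∃ w, w ∈ W ∧ w ∈ ends i))) : Set ι)) z) ↔
      (y ∈ openCluster (ends '' (↑s : Set ι)) z ∧ y ∈ openCluster (ends '' (↑(E₀ \ s) : Set ι)) z) := by
    intro y
    have h := congrArg (fun S : Set V => y ∈ S) hD
    simpa only [Set.mem_inter_iff, eq_iff_iff] using h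
  have hF : E₀.filter (fun i => ∀ y ∈ ends i,
        (y ∈ openCluster (ends '' (↑(s ∆ E₀.filter (fun i => ∃ w, w ∈ W ∧ w ∈ ends i)) : Set ι)) z ∨
          y ∈ openCluster (ends '' (↑(E₀ \ (s ∆ E₀.filter (fun i => ∃ w, w ∈ W ∧ w ∈ ends i))) : Set ι)) z) ∧
        ¬ (y ∈ openCluster (ends '' (↑(s ∆ E₀.filter (fun i => ∃ w, w ∈ W ∧ w ∈ ends i)) : Set ι)) z ∧
          y ∈ openCluster (ends '' (↑(E₀ \ (s ∆ E₀.filter (fun i => ∃ w, w ∈ W ∧ w ∈ ends i))) : Set ι)) z)) =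
      E₀.filter (fun i => ∀ y ∈ ends i,
        (y ∈ openCluster (ends '' (↑s : Set ι)) z ∨ y ∈ openCluster (ends '' (↑(E₀ \ s) : Set ι)) z) ∧
        ¬ (y ∈ openCluster (ends '' (↑s : Set ι)) z ∧ y ∈ openCluster (ends '' (↑(E₀ \ s) : Set ι)) z)) := by
    apply Finset.filter_congr
    intro i hi
    constructor
    · intro h y hy
      exact ⟨(hUy y).mp (h y hy).1, fun hd => (h y hy).2 ((hDy y).mpr hd)⟩
    · intro h y hy
      exact ⟨(hUy y).mpr (h y hy).1, fun hd => (h y hy).2 ((hDy y).mp hd)⟩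
  rw [hF]

end Coefficientwise

end Summit.CriticalPhenomena.PercolationContinuityZ3.Theorems
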